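import Summits.QuantumFields.BalabanUV.T4Continuum.Support.NE3QbarIterCovLift
import Summits.QuantumFields.BalabanUV.T4Continuum.Support.NE3CovariantLineSumsTower
import Summits.QuantumFields.BalabanUV.T4Continuum.Support.NE3FramePotBoundW
import Summits.QuantumFields.BalabanUV.T4Continuum.Support.NE3NearScalarSolve
import HarnessLib

/-!
# T⁴ programme, node NE3 — route Π, row Π-R (curved step), file Π-R-W5: THE EXACT SMOOTH RIGHT INVERSE OF THE LINEARISED (k+1)-FOLD
# AVERAGE AT A CURVED SMALL-FIELD BACKGROUND — `dirIter L (k+1) W (rightInvW … φ) = φ`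

NE3 (node U1b) formalisation swarm, leaf seat `b2b-balaban-t4-ne3-formalise-leaf-01` (gen 8); re-planned row Π-R-W (FINDING F-ne3leaf01g8-1,
`HOME/CLAIMS.log` 2026-08-20 ≈23:04Z; owner rulings ρ-g24-3 (4), ρ-g25-1 (2): «interface `dirIter L (j+1) W (R_W φ) = φ` EXACT, θ < 1 only»).
THE CONSTRUCTION.  On the finite-dimensional real space `E = skewSub d n N` of 𝔲(n)-valued coarse fields on the torus `[0,N)^d` let
`K ψ := QbarIter L (k+1) W (covLift M W (ext ψ)) − ext ψ` restricted to the torus (`straightDefect`; real-linear by `QbarIter_add`∕`QbarIter_smul` and the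
linearity of the lift; skew-preserving).  By the crux estimate W4c (`NE3QbarIterCovLift.norm_QbarIter_covLift_sub_le_of_sup`) `‖K ψ‖_∞ ≤ θ‖ψ‖_∞` with
**`θ = cruxC d L · (L^{k+1})² · x`**; for `θ < 1` the owner's near-scalar solve (`NE3NearScalarSolve.nearScalarInv`, `t = 1`, `κ = θ`) inverts `1 + K`
with `‖(1+K)⁻¹ ρ‖_∞ ≤ ‖ρ‖_∞∕(1 − θ)`, and **`rightInvW … φ := hatInvW L k W (ext ((1 + K)⁻¹ (res φ)))`** (W3's lift + covariant corrector applied to the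
solved datum).  THE END **`dirIter_rightInvW`**: for `L ≥ 2`, a unitary `(L^{k+1}·N)`-periodic `W` in the multi-level small-field class, `θ < 1`, and a
skew `N`-periodic coarse `φ`: `dirIter L (k+1) W (rightInvW … φ) = φ` — EXACTLY (W3 `dirIter_hatInvW` + `nearScalarInv_eq` + `extDir_resDir`).

CONTENT ([folklore]; 0 sorry; DATA defs `straightDefect`, `straightDefectSkew`, `solveW`, `rightInvW`): §1 linearity and structure through the tower
(`covLift_add`, `covLift_smul`, `Qbar_smul`, `QbarIter_smul`, `isSkewDir_QbarIter`); §2 the torus operator `straightDefect` and its sup bound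
`norm_straightDefect_le`; §3 the solve and **`rightInvW`** (skew, periodic, the solved datum's bound `norm_solveW_le`); §4 **`dirIter_rightInvW`**.

HONEST FRAMING.  Kinematics∕finite-dimensional linear algebra of OUR objects at one background; the smallness `θ < 1` is an EXPLICIT binder (a class
smallness: `(L^{k+1})²x` is the regime's ε); the size LETTERS (R1)–(R6′) of `rightInvW` are W6 (open); nothing about minimisers; (P♮)_W, T-E_w and
**NE3 are NOT proved**; spine PROVED 0∕9; finite T⁴ rung (B)+1 — NOT infinite volume, NOT mass gap, NOT `BetaPertH`, NOT Clay.  PLACEMENT: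
`Summits/QuantumFields/BalabanUV/`.  HONEST DEPENDENCY (cell page 1): continuum YM on T⁴ ⇐ BetaPertH ∧ nine spine estimates (0/9 proved); BetaPertH ⇐ (D1)
∧ (D4) ∧ CAP+tail; G-an2-4 gates asym, D1 and NE2/3/4.
-/

set_option autoImplicit false

open scoped BigOperators Matrix.Norms.L2Operator
open Finset

namespace Summit.QuantumFields.BalabanUV.T4Continuum.NE3SmoothRightInverseW

open Literature.MathematicalPhysics.QuantumFieldTheory.Balaban1983to89
open B7Prop1Explicit B7Prop2Explicit
open T4AveragingDeficitWall (IsUnitaryCfg IsSkewDir SmallField Ad)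
open T4AveragingDeficitWallBoundary (IsPeriodicCfg)
open AveragingDeficitPeriodicCounting (IsPeriodicDir)
open AveragingDeficitTransport (Ad_mem_skewAdjoint)
open AveragingDeficitTransportCalc (dhol_smul)
open AveragingDeficitNearIdentity (Ad_add Ad_real_smul)
open AveragingDeficitResidualPairing (pushDir)
open AveragingDeficitPushForwardLinear (pushDir_smul)
open AveragingDeficitChartCalculus (cavg)
open AveragingDeficitMultiLevelPrep (cavgIter LevelSmall tower natCast_tower_succ)
open AveragingDeficitTorusChart (TDir extDir resDir redN redN_boxVec extDir_resDir resDir_extDir isPeriodicDir_extDir)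
open AveragingDeficitTwoLevelPrep (skewSub mem_skewSub)
open AveragingDeficitFermat (isPeriodicCfg_cavg)
open BlockAveragePushDirGauge (gaugeDir isPeriodicDir_gaugeDir)
open BlockAveragePushDirSplit (frameLin dbarLin)
open NE3TangentCovariantStructure (Qbar Qbar_skew Qbar_add_period norm_Wcx_sub_one_le_32)
open NE3TangentCovariantTower (dirIter QbarIter step_small)
open NE3CovariantTentInterpolant (tinterpW tinterpW_mem_skewAdjoint tinterpW_add_period)
open NE3SmoothLiftFlat (smoothLift)
open NE3LandauOrbit (gaugeDir_skew)
open NE3FramePotBoundW (isPeriodicDir_QbarIter)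
open NE3CovariantLineSumsTower (QbarIter_add)
open NE3CovariantLift (covLift hatInvW frameGen isSkewDir_covLift covLift_add_period_tower frameGen_skew frameGen_add_period dirIter_hatInvW)
open NE3SmoothLiftW (tower_eq_pow_mul)
open NE3QbarIterCovLiftPrep (cruxC)
open NE3QbarIterCovLift (norm_QbarIter_covLift_sub_le_of_sup)
open NE3NearScalarSolve (nearScalarInv nearScalarInv_eq norm_smul_abs norm_nearScalarInv_le)

noncomputable section

variable {d : ℕ} {n : Type*} [Fintype n] [DecidableEq n]

/-! ## §1 Linearity of the lift and of the double-bar tower; skewness through the tower -/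

/-- The covariant lift is additive in the coarse field. [folklore] -/
theorem covLift_add (M : ℕ) (W : Site d → Fin d → (Matrix n n ℂ)ˣ) (φ ψ : Site d → Fin d → Matrix n n ℂ) :
    covLift M W (φ + ψ) = fun x κ => covLift M W φ x κ + covLift M W ψ x κ := by
  funext x κ
  simp only [covLift, smoothLift, Pi.add_apply, smul_add, Ad_add]

/-- The covariant lift is real-homogeneous in the coarse field. [folklore] -/
theorem covLift_smul (M : ℕ) (W : Site d → Fin d → (Matrix n n ℂ)ˣ) (c : ℝ) (φ : Site d → Fin d → Matrix n n ℂ) :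
    covLift M W (c • φ) = c • covLift M W φ := by
  funext x κ
  simp only [covLift, smoothLift, Pi.smul_apply, Ad_real_smul]
  rw [smul_comm]

/-- The linearised frame is real-homogeneous. [folklore] -/
theorem frameLin_smul (L : ℕ) (W : Site d → Fin d → (Matrix n n ℂ)ˣ) (c : ℝ) (Y : Site d → Fin d → Matrix n n ℂ) (y : Site d) :
    frameLin L W (c • Y) y = c • frameLin L W Y y := by
  unfold frameLin
  rw [Finset.smul_sum]
  exact Finset.sum_congr rfl fun r _ => by rw [dhol_smul, smul_comm]

/-- **`Qbar` IS REAL-HOMOGENEOUS** (in the loop ball of the small-field class). [folklore] -/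
theorem Qbar_smul [Nonempty n] {L : ℕ} (hL : 1 ≤ L) {W : Site d → Fin d → (Matrix n n ℂ)ˣ} (hWu : IsUnitaryCfg W) {a : ℝ} (ha : 0 ≤ a)
    (h512 : 512 * (d + 1) * (d + 4) * (L : ℝ) ^ 2 * a ≤ 1) (hWa : SmallField W a) (c : ℝ) (Y : Site d → Fin d → Matrix n n ℂ) :
    Qbar L W (c • Y) = c • Qbar L W Y := by
  funext z κ
  have hW := fun r => norm_Wcx_sub_one_le_32 hL hWu ha h512 hWa ((L : ℤ) • z) κ r
  show dbarLin L W (c • Y) ((L : ℤ) • z) κ = c • dbarLin L W Y ((L : ℤ) • z) κ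
  simp only [dbarLin, pushDir_smul L W c Y _ κ hW, frameLin_smul, Ad_real_smul, smul_sub]

/-- **THE k-FOLD DOUBLE-BAR AVERAGE IS REAL-HOMOGENEOUS** (multi-level small-field class). [folklore] -/
theorem QbarIter_smul [Nonempty n] {L : ℕ} (hL : 1 ≤ L) (j : ℕ) :
    ∀ {W : Site d → Fin d → (Matrix n n ℂ)ˣ} {x : ℝ}, IsUnitaryCfg W → 0 ≤ x → LevelSmall d L j x → SmallField W x →
    ∀ (c : ℝ) (Y : Site d → Fin d → Matrix n n ℂ), QbarIter L (j + 1) W (c • Y) = c • QbarIter L (j + 1) W Y := by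
  induction j with
  | zero =>
      intro W x hWu hx hs hWx c Y
      obtain ⟨h512, -, -, -⟩ := step_small hL hWu hx hs hWx
      exact Qbar_smul hL hWu hx h512 hWx c Y
  | succ j ih =>
      intro W x hWu hx hs hWx c Y
      obtain ⟨h512, hW₁u, hr0, hW₁x⟩ := step_small hL hWu hx hs.1 hWx
      show QbarIter L (j + 1) (cavg L W) (Qbar L W (c • Y)) = c • QbarIter L (j + 1) (cavg L W) (Qbar L W Y)
      rw [Qbar_smul hL hWu hx h512 hWx, ih hW₁u hr0 hs.2 hW₁x]

/-- **SKEWNESS THROUGH THE TOWER**: the k-fold double-bar average of a skew direction is skew (multi-level small-field class). [folklore] -/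
theorem isSkewDir_QbarIter [Nonempty n] {L : ℕ} (hL : 1 ≤ L) (j : ℕ) :
    ∀ {W : Site d → Fin d → (Matrix n n ℂ)ˣ} {x : ℝ}, IsUnitaryCfg W → 0 ≤ x → LevelSmall d L j x → SmallField W x →
    ∀ {Y : Site d → Fin d → Matrix n n ℂ}, IsSkewDir Y → IsSkewDir (QbarIter L (j + 1) W Y) := by
  induction j with
  | zero =>
      intro W x hWu hx hs hWx Y hY
      obtain ⟨h512, -, -, -⟩ := step_small hL hWu hx hs hWx
      exact Qbar_skew hL hWu hx h512 hWx hY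
  | succ j ih =>
      intro W x hWu hx hs hWx Y hY
      obtain ⟨h512, hW₁u, hr0, hW₁x⟩ := step_small hL hWu hx hs.1 hWx
      exact ih hW₁u hr0 hs.2 hW₁x (Qbar_skew hL hWu hx h512 hWx hY)

/-! ## §2 The torus operator `K = (QbarIter ∘ covLift − 1)` and its sup bound -/

section Operator

variable [Nonempty n] {L : ℕ} (hL : 2 ≤ L) (k : ℕ) {W : Site d → Fin d → (Matrix n n ℂ)ˣ} {x : ℝ} (hWu : IsUnitaryCfg W) (hx : 0 ≤ x)
  (hs : LevelSmall d L k x) (hWx : SmallField W x) (N : ℕ) [NeZero N]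

/-- **THE STRAIGHT DEFECT ON THE TORUS**: `K ψ := res (QbarIter L (k+1) W (covLift M W (ext ψ)) − ext ψ)`, a real-linear operator on the coarse torus
fields `TDir d n N` (`M = L^{k+1}`). [folklore] -/
def straightDefect : TDir d n N →ₗ[ℝ] TDir d n N where
  toFun ψ := resDir N (fun z κ => QbarIter L (k + 1) W (covLift (L ^ (k + 1)) W (extDir N ψ)) z κ - extDir N ψ z κ)
  map_add' ψ ψ' := by
    have hL1 : 1 ≤ L := by omega
    have hext : extDir N (ψ + ψ') = extDir N ψ + extDir N ψ' := by funext z κ; rfl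
    funext r κ
    simp only [resDir, Pi.add_apply, hext, covLift_add, QbarIter_add hL1 k hWu hx hs hWx]
    abel
  map_smul' c ψ := by
    have hL1 : 1 ≤ L := by omega
    have hext : extDir N (c • ψ) = c • extDir N ψ := by funext z κ; rfl
    funext r κ
    simp only [resDir, Pi.smul_apply, hext, covLift_smul, QbarIter_smul hL1 k hWu hx hs hWx, RingHom.id_apply, smul_sub]

/-- `K` evaluated. [folklore] -/
theorem straightDefect_apply (ψ : TDir d n N) (r : Fin d → Fin N) (κ : Fin d) :
    straightDefect hL k hWu hx hs hWx N ψ r κ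
      = QbarIter L (k + 1) W (covLift (L ^ (k + 1)) W (extDir N ψ)) (boxVec N r) κ - ψ r κ := by
  show QbarIter L (k + 1) W (covLift (L ^ (k + 1)) W (extDir N ψ)) (boxVec N r) κ - extDir N ψ (boxVec N r) κ = _
  simp only [extDir, redN_boxVec]

/-- **THE SUP BOUND OF `K`** (W4c): `‖K ψ‖_∞ ≤ θ·‖ψ‖_∞`, `θ = cruxC d L·(L^{k+1})²·x`. [folklore] -/
theorem norm_straightDefect_le (ψ : TDir d n N) :
    ‖straightDefect hL k hWu hx hs hWx N ψ‖ ≤ cruxC d L * (((L : ℝ) ^ (k + 1)) ^ 2 * x) * ‖ψ‖ := by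
  have hθ0 : 0 ≤ cruxC d L * (((L : ℝ) ^ (k + 1)) ^ 2 * x) * ‖ψ‖ := by
    have hc : 0 ≤ cruxC d L := by
      unfold cruxC; have := NE3QbarIterCovLiftPrep.liftC_nonneg d; have := NE3QbarIterCovLiftPrep.regC_nonneg d L
      have := NE3QbarIterCovLiftPrep.rhoC_nonneg d L; positivity
    positivity
  refine (pi_norm_le_iff_of_nonneg hθ0).mpr fun r => (pi_norm_le_iff_of_nonneg hθ0).mpr fun κ => ?_
  rw [straightDefect_apply]
  have hsup : ∀ (z' : Site d) (κ' : Fin d), ‖extDir N ψ z' κ'‖ ≤ ‖ψ‖ := fun z' κ' =>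
    (norm_le_pi_norm (ψ (redN N z')) κ').trans (norm_le_pi_norm ψ (redN N z'))
  have h := norm_QbarIter_covLift_sub_le_of_sup hL k hWu hx hs hWx (extDir N ψ) (norm_nonneg ψ) hsup (boxVec N r) κ
  simpa only [extDir, redN_boxVec] using h

/-- `K` preserves skewness. [folklore] -/
theorem straightDefect_mem_skewSub {ψ : TDir d n N} (hψ : ψ ∈ skewSub d n N) : straightDefect hL k hWu hx hs hWx N ψ ∈ skewSub d n N := by
  have hL1 : 1 ≤ L := by omega
  have hext : IsSkewDir (extDir N ψ) := fun z κ => (mem_skewSub.mp hψ) (redN N z) κ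
  have hQ := isSkewDir_QbarIter hL1 k hWu hx hs hWx (isSkewDir_covLift hWu (L ^ (k + 1)) hext)
  rw [mem_skewSub]
  intro r κ
  rw [straightDefect_apply]
  exact (skewAdjoint (Matrix n n ℂ)).sub_mem (hQ _ κ) (hψ r κ)

/-- `K` restricted to the 𝔲(n)-valued torus fields. [folklore] -/
def straightDefectSkew : ↥(skewSub d n N) →ₗ[ℝ] ↥(skewSub d n N) :=
  (straightDefect hL k hWu hx hs hWx N).restrict fun _ hψ => straightDefect_mem_skewSub hL k hWu hx hs hWx N hψ

/-- The sup bound of the restricted operator. [folklore] -/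
theorem norm_straightDefectSkew_le (ψ : ↥(skewSub d n N)) :
    ‖straightDefectSkew hL k hWu hx hs hWx N ψ‖ ≤ cruxC d L * (((L : ℝ) ^ (k + 1)) ^ 2 * x) * ‖ψ‖ :=
  norm_straightDefect_le hL k hWu hx hs hWx N (ψ : TDir d n N)

/-! ## §3 The solve and the right inverse -/

/-- **THE SOLVED DATUM** `(1 + K)⁻¹` on the 𝔲(n)-valued torus fields, for `θ < 1` (the owner's near-scalar solve, `t = 1`, `κ = θ`). [folklore] -/
def solveW (hθ : cruxC d L * (((L : ℝ) ^ (k + 1)) ^ 2 * x) < 1) : ↥(skewSub d n N) →ₗ[ℝ] ↥(skewSub d n N) :=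
  nearScalarInv norm_smul_abs norm_add_le (fun _ h => norm_eq_zero.1 h) (straightDefectSkew hL k hWu hx hs hWx N) zero_le_one hθ
    (norm_straightDefectSkew_le hL k hWu hx hs hWx N)

/-- `solveW` solves: `ψ + K ψ = ρ` for `ψ = solveW ρ`. [folklore] -/
theorem solveW_eq (hθ : cruxC d L * (((L : ℝ) ^ (k + 1)) ^ 2 * x) < 1) (ρ : ↥(skewSub d n N)) :
    solveW hL k hWu hx hs hWx N hθ ρ + straightDefectSkew hL k hWu hx hs hWx N (solveW hL k hWu hx hs hWx N hθ ρ) = ρ := by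
  have h := nearScalarInv_eq norm_smul_abs norm_add_le (fun _ h => norm_eq_zero.1 h) (straightDefectSkew hL k hWu hx hs hWx N) zero_le_one hθ
    (norm_straightDefectSkew_le hL k hWu hx hs hWx N) ρ
  rwa [one_smul] at h

/-- **THE SOLVED DATUM IS CONTROLLED**: `‖solveW ρ‖_∞ ≤ ‖ρ‖_∞ ∕ (1 − θ)`. [folklore] -/
theorem norm_solveW_le (hθ : cruxC d L * (((L : ℝ) ^ (k + 1)) ^ 2 * x) < 1) (ρ : ↥(skewSub d n N)) :
    ‖solveW hL k hWu hx hs hWx N hθ ρ‖ ≤ ‖ρ‖ / (1 - cruxC d L * (((L : ℝ) ^ (k + 1)) ^ 2 * x)) :=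
  norm_nearScalarInv_le (straightDefectSkew hL k hWu hx hs hWx N) zero_le_one hθ (norm_straightDefectSkew_le hL k hWu hx hs hWx N) ρ

/-- The restriction of a skew coarse field to the torus, as an element of `skewSub`. [folklore] -/
def resSkew {φ : Site d → Fin d → Matrix n n ℂ} (hφ : IsSkewDir φ) : ↥(skewSub d n N) := ⟨resDir N φ, fun r κ => hφ (boxVec N r) κ⟩

omit [Fintype n] [DecidableEq n] [Nonempty n] [NeZero N] in
/-- `resSkew` evaluated. [folklore] -/
theorem coe_resSkew {φ : Site d → Fin d → Matrix n n ℂ} (hφ : IsSkewDir φ) : ((resSkew N hφ : ↥(skewSub d n N)) : TDir d n N) = resDir N φ := rfl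

/-- **THE EXACT SMOOTH RIGHT INVERSE AT THE CURVED BACKGROUND**: `R_W φ := hatInvW L k W (ext ((1 + K)⁻¹ (res φ)))` (W3's transported lift plus covariant
corrector, applied to the solved coarse datum). [folklore] -/
def rightInvW (hθ : cruxC d L * (((L : ℝ) ^ (k + 1)) ^ 2 * x) < 1) {φ : Site d → Fin d → Matrix n n ℂ} (hφ : IsSkewDir φ) :
    Site d → Fin d → Matrix n n ℂ :=
  hatInvW L k W (extDir N ((solveW hL k hWu hx hs hWx N hθ (resSkew N hφ) : ↥(skewSub d n N)) : TDir d n N))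

/-- The solved coarse datum, extended periodically, is skew. [folklore] -/
theorem isSkewDir_extDir_solveW (hθ : cruxC d L * (((L : ℝ) ^ (k + 1)) ^ 2 * x) < 1) (ρ : ↥(skewSub d n N)) :
    IsSkewDir (extDir N ((solveW hL k hWu hx hs hWx N hθ ρ : ↥(skewSub d n N)) : TDir d n N)) := fun z κ =>
  (mem_skewSub.mp (solveW hL k hWu hx hs hWx N hθ ρ).2) (redN N z) κ

end Operator

/-! ## §4 Exactness -/

section Exact

variable [Nonempty n] {L : ℕ} (hL : 2 ≤ L) (k : ℕ) {N : ℕ} [NeZero N] {W : Site d → Fin d → (Matrix n n ℂ)ˣ} {x : ℝ}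
  (hWu : IsUnitaryCfg W) (hWP : IsPeriodicCfg W ((tower L N (k + 1) : ℕ) : ℤ)) (hx : 0 ≤ x) (hs : LevelSmall d L k x) (hWx : SmallField W x)
  (hθ : cruxC d L * (((L : ℝ) ^ (k + 1)) ^ 2 * x) < 1) {φ : Site d → Fin d → Matrix n n ℂ} (hφ : IsSkewDir φ) (hφP : IsPeriodicDir φ (N : ℤ))

include hL hWu hWP hx hs hWx hφP in
/-- **`D_W R_W φ = φ` EXACTLY.**  For `L ≥ 2`, a unitary `(L^{k+1}·N)`-periodic `W` in the multi-level small-field class with `θ = cruxC·(L^{k+1})²·x < 1`,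
and a skew `N`-periodic coarse field `φ`: `dirIter L (k+1) W (rightInvW … φ) = φ`. [folklore] -/
theorem dirIter_rightInvW : dirIter L (k + 1) W (rightInvW hL k hWu hx hs hWx N hθ hφ) = φ := by
  set ψ : ↥(skewSub d n N) := solveW hL k hWu hx hs hWx N hθ (resSkew N hφ) with hψ
  set Φ : Site d → Fin d → Matrix n n ℂ := extDir N (ψ : TDir d n N) with hΦ
  have hΦs : IsSkewDir Φ := isSkewDir_extDir_solveW hL k hWu hx hs hWx N hθ _
  have hΦP : IsPeriodicDir Φ (N : ℤ) := isPeriodicDir_extDir N _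
  -- W3: the frame part is killed exactly
  have h1 : dirIter L (k + 1) W (rightInvW hL k hWu hx hs hWx N hθ hφ) = QbarIter L (k + 1) W (covLift (L ^ (k + 1)) W Φ) :=
    dirIter_hatInvW hL k hWu hWP hx hs hWx hΦs hΦP
  -- the top field is `N`-periodic, so it is the extension of its restriction
  have hT : ((tower L N (k + 1) : ℕ) : ℤ) = ((L ^ (k + 1) * N : ℕ) : ℤ) := by rw [tower_eq_pow_mul]
  have hYP : IsPeriodicDir (covLift (L ^ (k + 1)) W Φ) ((tower L N (k + 1) : ℕ) : ℤ) := covLift_add_period_tower hL k hWP hΦP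
  have hQP : IsPeriodicDir (QbarIter L (k + 1) W (covLift (L ^ (k + 1)) W Φ)) (N : ℤ) := isPeriodicDir_QbarIter L N (k + 1) hWP hYP
  have h2 : QbarIter L (k + 1) W (covLift (L ^ (k + 1)) W Φ) = extDir N (resDir N (QbarIter L (k + 1) W (covLift (L ^ (k + 1)) W Φ))) :=
    (extDir_resDir N hQP).symm
  -- the restriction is `ψ + K ψ = res φ`
  have h3 : resDir N (QbarIter L (k + 1) W (covLift (L ^ (k + 1)) W Φ))
      = ((ψ + straightDefectSkew hL k hWu hx hs hWx N ψ : ↥(skewSub d n N)) : TDir d n N) := by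
    funext r κ
    rw [Submodule.coe_add, Pi.add_apply, Pi.add_apply]
    show _ = (ψ : TDir d n N) r κ + straightDefect hL k hWu hx hs hWx N (ψ : TDir d n N) r κ
    rw [straightDefect_apply]
    simp only [resDir, hΦ]
    abel
  rw [h1, h2, h3, solveW_eq, coe_resSkew, extDir_resDir N hφP]

include hL hWu hx hs hWx in
/-- The right inverse is a skew direction. [folklore] -/
theorem isSkewDir_rightInvW : IsSkewDir (rightInvW hL k hWu hx hs hWx N hθ hφ) := by
  have hM1 : 1 ≤ L ^ (k + 1) := Nat.one_le_pow _ _ (by omega)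
  have hΦs := isSkewDir_extDir_solveW hL k hWu hx hs hWx N hθ (resSkew N hφ)
  have hΦP : IsPeriodicDir (extDir N ((solveW hL k hWu hx hs hWx N hθ (resSkew N hφ) : ↥(skewSub d n N)) : TDir d n N)) (N : ℤ) :=
    isPeriodicDir_extDir N _
  intro y μ
  unfold rightInvW hatInvW
  refine (skewAdjoint (Matrix n n ℂ)).add_mem (isSkewDir_covLift hWu _ hΦs y μ) (gaugeDir_skew hWu (fun w => ?_) y μ)
  exact tinterpW_mem_skewAdjoint _ hWu (fun z => (skewAdjoint (Matrix n n ℂ)).neg_mem (frameGen_skew hL k hWu hx hs hWx hΦs z)) w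

include hL hWP in
omit [Nonempty n] in
/-- The right inverse is `(L^{k+1}·N)`-periodic. [folklore] -/
theorem isPeriodicDir_rightInvW [Nonempty n] : IsPeriodicDir (rightInvW hL k hWu hx hs hWx N hθ hφ) ((tower L N (k + 1) : ℕ) : ℤ) := by
  have hM1 : 1 ≤ L ^ (k + 1) := Nat.one_le_pow _ _ (by omega)
  set ψ : ↥(skewSub d n N) := solveW hL k hWu hx hs hWx N hθ (resSkew N hφ) with hψ
  have hΦP : IsPeriodicDir (extDir N (ψ : TDir d n N)) (N : ℤ) := isPeriodicDir_extDir N _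
  have hT : ((tower L N (k + 1) : ℕ) : ℤ) = (((L ^ (k + 1) : ℕ) : ℤ)) * N := by rw [tower_eq_pow_mul]; push_cast; ring
  have hWP' : IsPeriodicCfg W ((((L ^ (k + 1) : ℕ) : ℤ)) * N) := by rw [← hT]; exact hWP
  have hA : IsPeriodicDir (covLift (L ^ (k + 1)) W (extDir N (ψ : TDir d n N))) ((tower L N (k + 1) : ℕ) : ℤ) :=
    covLift_add_period_tower hL k hWP hΦP
  have hG : ∀ (z : Site d) (i : Fin d), (fun z => -frameGen L k W (extDir N (ψ : TDir d n N)) z) (z + (N : ℤ) • e i)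
      = (fun z => -frameGen L k W (extDir N (ψ : TDir d n N)) z) z := fun z i => by
    simp only [frameGen_add_period hL k hWP hΦP z i]
  have hlamP : ∀ (y : Site d) (i : Fin d), tinterpW (L ^ (k + 1)) W (fun z => -frameGen L k W (extDir N (ψ : TDir d n N)) z)
      (y + ((tower L N (k + 1) : ℕ) : ℤ) • e i) = tinterpW (L ^ (k + 1)) W (fun z => -frameGen L k W (extDir N (ψ : TDir d n N)) z) y := by
    intro y i
    rw [hT, show (((L ^ (k + 1) : ℕ) : ℤ)) * (N : ℤ) = ((L ^ (k + 1) * N : ℕ) : ℤ) by push_cast; ring]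
    exact tinterpW_add_period hM1 hWP' hG y i
  intro y i μ
  unfold rightInvW hatInvW
  rw [hA y i μ, isPeriodicDir_gaugeDir hWP hlamP y i μ]

end Exact

end

end Summit.QuantumFields.BalabanUV.T4Continuum.NE3SmoothRightInverseW
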